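import Literature.Probability.RandomPlanarGeometry.HexSAWStripSurfaceAdsorbedLocality
import HarnessLib

/-!
# Strips adsorb below `μ²`: a kernel instance of the truncated-Kesten certificate for the honeycomb surface model

`HexSAWStripSurfaceAdsorbedLocality` proves the **finite-data certificate**
`one_le_sq_stripMuY₀_mul`: if `Σ_{k=1}^{D} Λ_{2k}(y) x^k ≥ 1` for some `x > 0`, where `Λ_n(y)` (`IPWB n y`) is the
weight of the `n`-step *irreducible positive wall bridges* of the brick-wall (honeycomb) lattice with a wall at `Y = 0`
and fugacity `y` per surface visit, then `μ_T(y,1)² ≥ 1/x` for **every** strip height `T ≥ D` (and hence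
`μ(y)² = β(y)² ≥ 1/x`). This file supplies an INSTANCE of that certificate inside the kernel:

* `listWalk`, `PieceCheck`, `listWalk_mem_ipwb` — a walk read off an explicit coordinate list is an irreducible positive
  wall bridge with at least one surface visit as soon as a DECIDABLE list of coordinate checks holds (start `0`,
  brick-wall steps, self-avoidance, `Y ≤ 0`, `Y_n = 0`, `0 < X_i ≤ X_n`, no interior even-time wall contact); the checks
  are discharged by `decide`.
* `length_mul_le_IPWB` — `m` distinct such lists give `m·y ≤ Λ_n(y)` (`y ≥ 1`).
* the data: the twelve irreducible positive wall bridges of lengths `2, 6, 8, 10, 10, 10, 12, …, 12` with exactly one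
  surface visit (`adwPieces2 … adwPieces12`; enumerated by brute force and re-verified here by `decide`), whence
  `Λ₂(y) ≥ y`, `Λ₆(y) ≥ y`, `Λ₈(y) ≥ y`, `Λ₁₀(y) ≥ 3y`, `Λ₁₂(y) ≥ 6y` (`y ≥ 1`) and the certificate
  `certificate_six_of_three_le : 1 ≤ Σ_{k=1}^{6} Λ_{2k}(y)·(117/400)^k` for every `y ≥ 3`.
* ★ `hexConnectiveConstant_lt_stripMuY₀_of_three_le` — **for every wall fugacity `y ≥ 3` and every strip height
  `T ≥ 6`, `μ_T(y,1) > μ = √(2+√2)`** (the bulk honeycomb connective constant, Duminil-Copin–Smirnov):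
  `μ_T(y,1)² ≥ 400/117 > 2 + √2`. For `3 ≤ y < μ²` the a-priori bound `μ_T(y,1) ≥ √y` does not give this; the
  theorem is an explicit, finite-height witness of adsorption (`μ(y) > μ` for `y > y_c = 1 + √2`,
  Beaton–Bousquet-Mélou–de Gier–Duminil-Copin–Guttmann, Theorem 2) obtained from finitely many wall bridges.
  Also `hexConnectiveConstant_lt_stripMuY₀_of_ten_thirds_le` (`y ≥ 10/3`, two pieces, every `T ≥ 3`),
  `hexConnectiveConstant_lt_stripMuY₀_of_sq_lt` (the trivial regime `y > 2+√2`, every `T ≥ 1`) and the explicit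
  `le_sq_surfaceMu_of_three_le : 400/117 ≤ μ(y)²`, `hexConnectiveConstant_lt_surfaceMu_of_three_le`.
* `hexConnectiveConstant_lt_stripMuY₀_of_certificate` — the general form: any certificate with `(2+√2)·x < 1` proves
  `μ < μ_T(y,1)` for all `T ≥ D` (and `hexConnectiveConstant_lt_surfaceMu_of_certificate`).

All statements are over the tree's definitions (`saws`, `hpw`, `wbr`, `visits`, `stripMuY₀`, `HV.surfaceMu`) and the
wall-renewal objects `pwb`, `ipwb`, `IPWB` of `HexSAWSurfaceWallRenewal`.

References: N. Madras, G. Slade, *The Self-Avoiding Walk* (1993), §4.2 (Kesten's irreducible bridges, (4.2.4));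
N. R. Beaton, M. Bousquet-Mélou, J. de Gier, H. Duminil-Copin, A. J. Guttmann, *The critical fugacity for surface
adsorption of self-avoiding walks on the honeycomb lattice is 1+√2*, CMP 326 (2014), Theorem 2, §3.1 Prop. 5,
Prop. 7 / Cor. 8 (arXiv:1109.0358v5); A. J. Guttmann, I. Jensen, *Effect of confinement: polygons in strips, slabs and
rectangles*, Ch. 10 of LNP 775 (2009), §10.1 (honeycomb drawn as a brickwork lattice, footnote 1; Table 10.1 = numerical growth
constants μ_d of lattice POLYGONS in strips, an illustration only); H. Duminil-Copin, S. Smirnov, Ann. Math. 175 (2012), Thm 1.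
-/

noncomputable section

open Finset
open Literature.Probability.LatticeModels SimpleGraph

namespace Literature.Probability.RandomPlanarGeometry.SAW.HexBW.Wall

variable {n : ℕ} {y : ℝ}

/-! ### §1 Walks from coordinate lists and the decidable piece check -/

/-- Brick-wall adjacency of integer pairs — the coordinate form `brickWallGraph_adj_coord` transported to `ℤ × ℤ`
(a horizontal step, or a vertical step along a bond `{(a,b),(a,b+1)}` with `a+b` even).
[cite: GuttmannJensen2009Confinement, §10.1, footnote 1 ("We draw the honeycomb lattice as a brickwork lattice")] -/
def bwAdjZ (p q : ℤ × ℤ) : Prop :=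
  ((q.1 = p.1 + 1 ∨ p.1 = q.1 + 1) ∧ q.2 = p.2) ∨
    (q.1 = p.1 ∧ ((q.2 = p.2 + 1 ∧ (p.1 + p.2) % 2 = 0) ∨ (p.2 = q.2 + 1 ∧ (q.1 + q.2) % 2 = 0)))

/-- `bwAdjZ` is decidable. [folklore] -/
instance bwAdjZ.decidable : DecidableRel bwAdjZ := fun p q => by unfold bwAdjZ; infer_instance

/-- **The walk read off a coordinate list**, frozen at time `n`: `ω i = l[min i n]` (default `0` past the end of `l`).
[cite: MadrasSlade1993, §1.1] -/
def listWalk (l : List (ℤ × ℤ)) (n : ℕ) : ℕ → Site 2 := fun i => ![(l.getD (min i n) 0).1, (l.getD (min i n) 0).2]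

/-- First coordinate of `listWalk`. [cite: MadrasSlade1993, §1.1] -/
theorem listWalk_apply_zero (l : List (ℤ × ℤ)) (n i : ℕ) : listWalk l n i 0 = (l.getD (min i n) 0).1 := rfl

/-- Second coordinate of `listWalk`. [cite: MadrasSlade1993, §1.1] -/
theorem listWalk_apply_one (l : List (ℤ × ℤ)) (n i : ℕ) : listWalk l n i 1 = (l.getD (min i n) 0).2 := rfl

/-- Lists of the right length are recovered from their walks. [cite: MadrasSlade1993, §1.1] -/
theorem listWalk_inj {l₁ l₂ : List (ℤ × ℤ)} (h₁ : l₁.length = n + 1) (h₂ : l₂.length = n + 1)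
    (h : listWalk l₁ n = listWalk l₂ n) : l₁ = l₂ := by
  refine List.ext_getElem (by rw [h₁, h₂]) fun i hi₁ hi₂ => ?_
  have hi : i ≤ n := by omega
  have e0 := congrFun (congrFun h i) 0
  have e1 := congrFun (congrFun h i) 1
  rw [listWalk_apply_zero, listWalk_apply_zero, min_eq_left hi] at e0
  rw [listWalk_apply_one, listWalk_apply_one, min_eq_left hi] at e1
  rw [← List.getD_eq_getElem l₁ (0 : ℤ × ℤ) hi₁, ← List.getD_eq_getElem l₂ (0 : ℤ × ℤ) hi₂]
  exact Prod.ext e0 e1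

/-- **The decidable piece check** on a coordinate list `l` for horizon `n`: start at `0`; brick-wall steps; injective
on `[0,n]`; `Y ≤ 0`; `Y_n = 0`; `0 < X_i ≤ X_n` for `1 ≤ i ≤ n` (a bridge in the strict-start sense); and no wall
contact at an interior even time (so no wall-renewal time: the piece is irreducible, with exactly the final visit).
[cite: MadrasSlade1993, Definition 1.2.4 and §4.2, Definition 4.2.1] -/
def PieceCheck (n : ℕ) (l : List (ℤ × ℤ)) : Prop :=
  l.getD 0 0 = (0, 0) ∧
  (∀ i < n, bwAdjZ (l.getD i 0) (l.getD (i + 1) 0)) ∧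
  (∀ i ≤ n, ∀ j ≤ n, l.getD i 0 = l.getD j 0 → i = j) ∧
  (∀ i ≤ n, (l.getD i 0).2 ≤ 0) ∧
  (l.getD n 0).2 = 0 ∧
  (∀ i ≤ n, 1 ≤ i → 0 < (l.getD i 0).1 ∧ (l.getD i 0).1 ≤ (l.getD n 0).1) ∧
  (∀ k < n, 1 ≤ k → k % 2 = 0 → (l.getD k 0).2 ≠ 0)

/-- `PieceCheck` is decidable (all quantifiers are bounded). [folklore] -/
instance PieceCheck.decidable (n : ℕ) (l : List (ℤ × ℤ)) : Decidable (PieceCheck n l) := by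
  unfold PieceCheck; infer_instance

/-- **A checked list is an irreducible positive wall bridge with at least one surface visit.**
[cite: MadrasSlade1993, Definition 1.2.4 and §4.2, Definition 4.2.1; BeatonBousquetMelouDeGierDuminilCopinGuttmann2014, §3.1 (arXiv v5 p. 8)] -/
theorem listWalk_mem_ipwb (l : List (ℤ × ℤ)) (hn1 : 1 ≤ n) (hn : n % 2 = 0) (h : PieceCheck n l) :
    listWalk l n ∈ ipwb n ∧ 1 ≤ visits n (listWalk l n) := by
  obtain ⟨h0, hadj, hinj, hhp, hend, hbr, hint⟩ := h
  have hc0 : ∀ {i}, i ≤ n → listWalk l n i 0 = (l.getD i 0).1 := fun hi => by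
    rw [listWalk_apply_zero, min_eq_left hi]
  have hc1 : ∀ {i}, i ≤ n → listWalk l n i 1 = (l.getD i 0).2 := fun hi => by
    rw [listWalk_apply_one, min_eq_left hi]
  have h00 : listWalk l n 0 0 = 0 := by rw [hc0 (Nat.zero_le _), h0]
  have h01 : listWalk l n 0 1 = 0 := by rw [hc1 (Nat.zero_le _), h0]
  have hXn : 0 < listWalk l n n 0 := by rw [hc0 le_rfl]; exact (hbr n le_rfl hn1).1
  have hsaws : listWalk l n ∈ saws n := by
    refine mem_saws_iff.2 ⟨?_, fun i hi => ?_, fun i hi => ?_, fun i hi j hj hij => ?_⟩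
    · ext j
      fin_cases j
      · exact h00
      · exact h01
    · simp only [listWalk, min_eq_right hi, min_self]
    · rw [brickWallGraph_adj_coord, hc0 hi.le, hc0 hi, hc1 hi.le, hc1 hi]
      exact hadj i hi
    · have e0 := congrFun hij 0
      have e1 := congrFun hij 1
      have hi' : i ≤ n := hi
      have hj' : j ≤ n := hj
      rw [hc0 hi', hc0 hj'] at e0
      rw [hc1 hi', hc1 hj'] at e1
      exact hinj i hi' j hj' (Prod.ext e0 e1)
  have hhpw : listWalk l n ∈ hpw n := mem_hpw.2 ⟨hsaws, fun i hi => by rw [hc1 hi]; exact hhp i hi⟩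
  have harch : listWalk l n ∈ archs n := mem_archs.2 ⟨hhpw, hn, by rw [hc1 le_rfl]; exact hend⟩
  have hwbr : listWalk l n ∈ wbr n := by
    refine mem_wbr.2 ⟨harch, fun i hi => ?_⟩
    rw [h00]
    rcases Nat.eq_zero_or_pos i with rfl | hi1
    · rw [h00]; exact ⟨le_rfl, hXn.le⟩
    · rw [hc0 hi, hc0 le_rfl]
      exact ⟨(hbr i hi hi1).1.le, (hbr i hi hi1).2⟩
  have hpwb : listWalk l n ∈ pwb n := by
    refine mem_pwb.2 ⟨hwbr, fun i hi1 hi => ?_⟩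
    rw [h00, hc0 hi, hc0 le_rfl]
    exact hbr i hi hi1
  refine ⟨mem_ipwb.2 ⟨hpwb, hn1, fun k hk1 hkn hW => hint k hkn hk1 hW.2.1 ?_⟩, ?_⟩
  · rw [← hc1 hkn.le]; exact hW.2.2
  · obtain ⟨m, rfl⟩ : ∃ m, n = m + 1 := ⟨n - 1, by omega⟩
    rw [visits_succ, if_pos ⟨hn, by rw [hc1 le_rfl]; exact hend⟩]
    omega

/-- **Exhibited members bound `Λ_n(y)` from below**: for `y ≥ 1`, a finset `S ⊆ ipwb n` of walks with `≥ 1` visit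
gives `|S|·y ≤ Λ_n(y)`. [cite: MadrasSlade1993, §4.2, (4.2.2)] -/
theorem card_mul_le_IPWB (hy : 1 ≤ y) (S : Finset (ℕ → Site 2))
    (hS : ∀ ω ∈ S, ω ∈ ipwb n ∧ 1 ≤ visits n ω) : (S.card : ℝ) * y ≤ IPWB n y := by
  classical
  calc (S.card : ℝ) * y = ∑ _ω ∈ S, y := by rw [Finset.sum_const, nsmul_eq_mul]
    _ ≤ ∑ ω ∈ S, y ^ visits n ω := Finset.sum_le_sum fun ω hω => by
        calc y = y ^ 1 := (pow_one y).symm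
          _ ≤ y ^ visits n ω := pow_le_pow_right₀ hy (hS ω hω).2
    _ ≤ ∑ ω ∈ ipwb n, y ^ visits n ω :=
        Finset.sum_le_sum_of_subset_of_nonneg (fun ω hω => (hS ω hω).1)
          fun _ _ _ => pow_nonneg (zero_le_one.trans hy) _
    _ = IPWB n y := rfl

/-- **`m` distinct checked lists give `m·y ≤ Λ_n(y)`** (`y ≥ 1`). [cite: MadrasSlade1993, §4.2, (4.2.2)] -/
theorem length_mul_le_IPWB {m : ℕ} (hy : 1 ≤ y) (hn1 : 1 ≤ n) (hn : n % 2 = 0) (Ls : List (List (ℤ × ℤ)))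
    (hchk : ∀ l ∈ Ls, PieceCheck n l) (hnd : Ls.Nodup) (hlen : ∀ l ∈ Ls, l.length = n + 1)
    (hm : Ls.length = m) : (m : ℝ) * y ≤ IPWB n y := by
  classical
  set S := (Ls.map fun l => listWalk l n).toFinset with hS
  have hcard : S.card = m := by
    rw [hS, List.toFinset_card_of_nodup, List.length_map, hm]
    exact hnd.map_on fun l₁ h₁ l₂ h₂ h => listWalk_inj (hlen l₁ h₁) (hlen l₂ h₂) h
  have hmem : ∀ ω ∈ S, ω ∈ ipwb n ∧ 1 ≤ visits n ω := by
    intro ω hω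
    rw [hS, List.mem_toFinset, List.mem_map] at hω
    obtain ⟨l, hl, rfl⟩ := hω
    exact listWalk_mem_ipwb l hn1 hn (hchk l hl)
  rw [← hcard]
  exact card_mul_le_IPWB hy S hmem

/-! ### §2 The data: the irreducible positive wall bridges with one surface visit, lengths `2 … 12` -/

/-- Length `2`: the two steps along the wall (found by a brute-force enumeration of the irreducible positive wall bridges,
lane script `hexpwb_bruteforce.py`; re-verified by `decide` below). [cite: MadrasSlade1993, §4.2 Definition 4.2.1 (irreducible bridges)] -/
def adwPieces2 : List (List (ℤ × ℤ)) := [[(0, 0), (1, 0), (2, 0)]]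

/-- Length `6`: the hook `(0,0)(1,0)(1,-1)(2,-1)(3,-1)(3,0)(4,0)` (brute-force enumeration; re-verified by `decide` below).
[cite: MadrasSlade1993, §4.2 Definition 4.2.1 (irreducible bridges)] -/
def adwPieces6 : List (List (ℤ × ℤ)) := [[(0, 0), (1, 0), (1, -1), (2, -1), (3, -1), (3, 0), (4, 0)]]

/-- Length `8`: the long hook (brute-force enumeration; re-verified by `decide` below).
[cite: MadrasSlade1993, §4.2 Definition 4.2.1 (irreducible bridges)] -/
def adwPieces8 : List (List (ℤ × ℤ)) :=
  [[(0, 0), (1, 0), (1, -1), (2, -1), (3, -1), (4, -1), (5, -1), (5, 0), (6, 0)]]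

/-- Length `10`: three pieces (brute-force enumeration; re-verified by `decide` below).
[cite: MadrasSlade1993, §4.2 Definition 4.2.1 (irreducible bridges)] -/
def adwPieces10 : List (List (ℤ × ℤ)) :=
  [[(0, 0), (1, 0), (1, -1), (2, -1), (2, -2), (3, -2), (4, -2), (4, -1), (3, -1), (3, 0), (4, 0)],
   [(0, 0), (1, 0), (1, -1), (2, -1), (2, -2), (3, -2), (4, -2), (4, -1), (5, -1), (5, 0), (6, 0)],
   [(0, 0), (1, 0), (1, -1), (2, -1), (3, -1), (4, -1), (5, -1), (6, -1), (7, -1), (7, 0), (8, 0)]]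

/-- Length `12`: the six one-visit pieces (a seventh irreducible piece of length `12` has two visits and is not used; brute-force
enumeration, re-verified by `decide` below). [cite: MadrasSlade1993, §4.2 Definition 4.2.1 (irreducible bridges)] -/
def adwPieces12 : List (List (ℤ × ℤ)) :=
  [[(0, 0), (1, 0), (1, -1), (2, -1), (2, -2), (3, -2), (4, -2), (4, -1), (5, -1), (6, -1), (7, -1), (7, 0), (8, 0)],
   [(0, 0), (1, 0), (1, -1), (2, -1), (2, -2), (3, -2), (4, -2), (5, -2), (6, -2), (6, -1), (5, -1), (5, 0), (6, 0)],
   [(0, 0), (1, 0), (1, -1), (2, -1), (2, -2), (3, -2), (4, -2), (5, -2), (6, -2), (6, -1), (7, -1), (7, 0), (8, 0)],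
   [(0, 0), (1, 0), (1, -1), (2, -1), (3, -1), (4, -1), (4, -2), (5, -2), (6, -2), (6, -1), (5, -1), (5, 0), (6, 0)],
   [(0, 0), (1, 0), (1, -1), (2, -1), (3, -1), (4, -1), (4, -2), (5, -2), (6, -2), (6, -1), (7, -1), (7, 0), (8, 0)],
   [(0, 0), (1, 0), (1, -1), (2, -1), (3, -1), (4, -1), (5, -1), (6, -1), (7, -1), (8, -1), (9, -1), (9, 0), (10, 0)]]

/-- `Λ₂(y) ≥ y` for `y ≥ 1` (one piece). [cite: MadrasSlade1993, §4.2, (4.2.2) (p. 90); BeatonBousquetMelouDeGierDuminilCopinGuttmann2014, §3.1 (arXiv v5 p. 9)] -/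
theorem one_mul_le_IPWB_two (hy : 1 ≤ y) : (1 : ℝ) * y ≤ IPWB 2 y := by
  exact_mod_cast length_mul_le_IPWB (n := 2) (m := 1) hy (by norm_num) (by norm_num) adwPieces2 (by decide) (by decide)
    (by decide) (by decide)

/-- `Λ₆(y) ≥ y` for `y ≥ 1` (one piece; kernel-checked by `decide`). [cite: MadrasSlade1993, §4.2, (4.2.2) (p. 90)] -/
theorem le_IPWB_six (hy : 1 ≤ y) : (1 : ℝ) * y ≤ IPWB 6 y := by
  exact_mod_cast length_mul_le_IPWB (n := 6) (m := 1) hy (by norm_num) (by norm_num) adwPieces6 (by decide) (by decide)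
    (by decide) (by decide)

/-- `Λ₈(y) ≥ y` for `y ≥ 1` (one piece; kernel-checked by `decide`). [cite: MadrasSlade1993, §4.2, (4.2.2) (p. 90)] -/
theorem le_IPWB_eight (hy : 1 ≤ y) : (1 : ℝ) * y ≤ IPWB 8 y := by
  exact_mod_cast length_mul_le_IPWB (n := 8) (m := 1) hy (by norm_num) (by norm_num) adwPieces8 (by decide) (by decide)
    (by decide) (by decide)

/-- `Λ₁₀(y) ≥ 3y` for `y ≥ 1` (three pieces; kernel-checked by `decide`). [cite: MadrasSlade1993, §4.2, (4.2.2) (p. 90)] -/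
theorem le_IPWB_ten (hy : 1 ≤ y) : (3 : ℝ) * y ≤ IPWB 10 y := by
  exact_mod_cast length_mul_le_IPWB (n := 10) (m := 3) hy (by norm_num) (by norm_num) adwPieces10 (by decide) (by decide)
    (by decide) (by decide)

/-- `Λ₁₂(y) ≥ 6y` for `y ≥ 1` (six pieces; kernel-checked by `decide`). [cite: MadrasSlade1993, §4.2, (4.2.2) (p. 90)] -/
theorem le_IPWB_twelve (hy : 1 ≤ y) : (6 : ℝ) * y ≤ IPWB 12 y := by
  exact_mod_cast length_mul_le_IPWB (n := 12) (m := 6) hy (by norm_num) (by norm_num) adwPieces12 (by decide) (by decide)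
    (by decide) (by decide)

/-! ### §3 The certificates and the strict inequalities -/

/-- `μ² = 2 + √2` (Duminil-Copin–Smirnov). [cite: DuminilCopinSmirnov2012, Thm 1] -/
private theorem sq_hexConnectiveConstant_eq_two_add_sqrt_two : hexConnectiveConstant ^ 2 = 2 + Real.sqrt 2 := by
  rw [hexConnectiveConstant_eq_of_thm1 DuminilCopinSmirnov2012_thm1_holds, Real.sq_sqrt (by positivity)]

/-- **Any certificate with `(2+√2)·x < 1` proves `μ < μ_T(y,1)` for every `T ≥ D`.**
[cite: MadrasSlade1993, §4.2, (4.2.4) (p. 91); DuminilCopinSmirnov2012, Thm 1] -/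
theorem hexConnectiveConstant_lt_stripMuY₀_of_certificate (hy : 0 < y) {D T : ℕ} (hD : 1 ≤ D) (hDT : D ≤ T)
    {x : ℝ} (hx : 0 < x) (hG : 1 ≤ ∑ k ∈ Icc 1 D, IPWB (2 * k) y * x ^ k) (hμx : (2 + Real.sqrt 2) * x < 1) :
    hexConnectiveConstant < stripMuY₀ T y := by
  have h1 := one_le_sq_stripMuY₀_mul hy hD hDT hx hG
  have h2 : hexConnectiveConstant ^ 2 < stripMuY₀ T y ^ 2 := by
    rw [sq_hexConnectiveConstant_eq_two_add_sqrt_two]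
    by_contra hle
    push Not at hle
    have := mul_le_mul_of_nonneg_right hle hx.le
    linarith
  exact lt_of_pow_lt_pow_left₀ 2 (stripMuY₀_pos T hy).le h2

/-- **Any certificate with `(2+√2)·x < 1` proves `μ < μ(y)`** (and `1/x ≤ μ(y)²`).
[cite: MadrasSlade1993, §4.2, (4.2.4) (p. 91); BeatonBousquetMelouDeGierDuminilCopinGuttmann2014, Prop. 7 with Cor. 8 (arXiv v5 pp. 11–12)] -/
theorem hexConnectiveConstant_lt_surfaceMu_of_certificate (hy : 0 < y) {D : ℕ} (hD : 1 ≤ D)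
    {x : ℝ} (hx : 0 < x) (hG : 1 ≤ ∑ k ∈ Icc 1 D, IPWB (2 * k) y * x ^ k) (hμx : (2 + Real.sqrt 2) * x < 1) :
    hexConnectiveConstant < HV.surfaceMu y :=
  (hexConnectiveConstant_lt_stripMuY₀_of_certificate hy hD le_rfl hx hG hμx).trans_le (stripMuY₀_le_surfaceMu D hy)

/-- **The six-term certificate for every `y ≥ 3`** (`D = 6`, `x = 117/400`): `Σ_{k=1}^{6} Λ_{2k}(y)(117/400)^k ≥
y·(x + x³ + x⁴ + 3x⁵ + 6x⁶) ≥ 3·0.33502… > 1` from the twelve one-visit pieces — a truncation of Kesten's relation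
`Σ_N Λ_N β^{-N} = 1` evaluated below its root (kernel-checked). [cite: MadrasSlade1993, §4.2, (4.2.4) (p. 91)] -/
theorem certificate_six_of_three_le (hy : 3 ≤ y) : 1 ≤ ∑ k ∈ Icc 1 6, IPWB (2 * k) y * ((117 : ℝ) / 400) ^ k := by
  have hy1 : (1 : ℝ) ≤ y := by linarith
  have h2 := one_mul_le_IPWB_two hy1
  have h4 : 0 ≤ IPWB 4 y := IPWB_nonneg _ (by linarith)
  have h6 := le_IPWB_six hy1
  have h8 := le_IPWB_eight hy1
  have h10 := le_IPWB_ten hy1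
  have h12 := le_IPWB_twelve hy1
  have hIcc : (Icc 1 6 : Finset ℕ) = {1, 2, 3, 4, 5, 6} := by
    ext k; simp only [Finset.mem_Icc, Finset.mem_insert, Finset.mem_singleton]; omega
  rw [hIcc, Finset.sum_insert (by simp), Finset.sum_insert (by simp), Finset.sum_insert (by simp),
    Finset.sum_insert (by simp), Finset.sum_insert (by simp), Finset.sum_singleton]
  norm_num at h2 h6 h8 h10 h12 ⊢
  nlinarith

/-- **★ Strips of height `T ≥ 6` adsorb for every `y ≥ 3`**: `400/117 ≤ μ_T(y,1)²` (kernel-checked instance of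
`one_le_sq_stripMuY₀_mul`). [cite: BeatonBousquetMelouDeGierDuminilCopinGuttmann2014, Corollary 8 (arXiv v5 p. 12); GuttmannJensen2009Confinement, §10.1, Table 10.1 (growth constants μ_d of honeycomb-lattice POLYGONS in strips of width d, "monotone increasing" in the printed numerical table — an illustration, not a theorem on walk rates)] -/
theorem le_sq_stripMuY₀_of_three_le (hy : 3 ≤ y) {T : ℕ} (hT : 6 ≤ T) : (400 : ℝ) / 117 ≤ stripMuY₀ T y ^ 2 := by
  have h := one_le_sq_stripMuY₀_mul (y := y) (by linarith) (D := 6) (by norm_num) hT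
    (x := (117 : ℝ) / 400) (by norm_num) (certificate_six_of_three_le hy)
  linarith

/-- **★ `μ < μ_T(y,1)` for every `y ≥ 3` and every `T ≥ 6`.** For `3 ≤ y < μ² = 2+√2 = 3.414…` the a-priori bound
`μ_T(y,1) ≥ √y` (`le_sq_stripMuY₀`) stays below `μ`, so this is a genuinely finite-data statement: twelve wall bridges of
length `≤ 12` force every strip of height `≥ 6` to outgrow the bulk honeycomb lattice — an explicit, finite-height
witness of surface adsorption (kernel-checked).
[cite: BeatonBousquetMelouDeGierDuminilCopinGuttmann2014, §3.1, Proposition 5 (arXiv v5 p. 9: "μ(y) ≥ max(μ, √y)") and Theorem 2 (arXiv v5 p. 3); DuminilCopinSmirnov2012, Thm 1] -/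
theorem hexConnectiveConstant_lt_stripMuY₀_of_three_le (hy : 3 ≤ y) {T : ℕ} (hT : 6 ≤ T) :
    hexConnectiveConstant < stripMuY₀ T y :=
  hexConnectiveConstant_lt_stripMuY₀_of_certificate (by linarith) (by norm_num) hT (by norm_num)
    (certificate_six_of_three_le hy) (by nlinarith [Real.sq_sqrt (show (0 : ℝ) ≤ 2 by norm_num), Real.sqrt_nonneg 2])

/-- **`400/117 ≤ μ(y)²` for every `y ≥ 3`**, in particular `μ(3) ≥ 1.849 > μ = 1.8477…` (kernel-checked).
[cite: BeatonBousquetMelouDeGierDuminilCopinGuttmann2014, §3.1, Proposition 5 (arXiv v5 p. 9); MadrasSlade1993, §4.2, (4.2.4) (p. 91)] -/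
theorem le_sq_surfaceMu_of_three_le (hy : 3 ≤ y) : (400 : ℝ) / 117 ≤ HV.surfaceMu y ^ 2 := by
  have h := one_le_sq_surfaceMu_mul (y := y) (by linarith) (D := 6) (by norm_num)
    (x := (117 : ℝ) / 400) (by norm_num) (certificate_six_of_three_le hy)
  linarith

/-- **`μ < μ(y)` for every `y ≥ 3`** from finitely many wall bridges (kernel-checked; the inequality itself is the case
`y ≥ 3 > y_c = 1+√2` of the adsorption theorem). [cite: BeatonBousquetMelouDeGierDuminilCopinGuttmann2014, Theorem 2 (arXiv v5 p. 3)] -/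
theorem hexConnectiveConstant_lt_surfaceMu_of_three_le (hy : 3 ≤ y) : hexConnectiveConstant < HV.surfaceMu y :=
  (hexConnectiveConstant_lt_stripMuY₀_of_three_le hy le_rfl).trans_le (stripMuY₀_le_surfaceMu 6 (by linarith))

/-- **The two-piece certificate for every `y ≥ 10/3`** (`D = 3`, `x = 7/24`): `y(x + x³) ≥ (10/3)·0.3165 > 1`
(kernel-checked). [cite: MadrasSlade1993, §4.2, (4.2.4) (p. 91)] -/
theorem certificate_three_of_ten_thirds_le (hy : 10 / 3 ≤ y) :
    1 ≤ ∑ k ∈ Icc 1 3, IPWB (2 * k) y * ((7 : ℝ) / 24) ^ k := by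
  have hy1 : (1 : ℝ) ≤ y := by linarith
  have h2 := one_mul_le_IPWB_two hy1
  have h4 : 0 ≤ IPWB 4 y := IPWB_nonneg _ (by linarith)
  have h6 := le_IPWB_six hy1
  have hIcc : (Icc 1 3 : Finset ℕ) = {1, 2, 3} := by
    ext k; simp only [Finset.mem_Icc, Finset.mem_insert, Finset.mem_singleton]; omega
  rw [hIcc, Finset.sum_insert (by simp), Finset.sum_insert (by simp), Finset.sum_singleton]
  norm_num at h2 h6 ⊢
  nlinarith

/-- **★ `μ < μ_T(y,1)` for every `y ≥ 10/3` and every `T ≥ 3`** (still `10/3 < μ²`): two pieces suffice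
(kernel-checked). [cite: BeatonBousquetMelouDeGierDuminilCopinGuttmann2014, §3.1, Proposition 5 (arXiv v5 p. 9) and Corollary 8 (arXiv v5 p. 12); DuminilCopinSmirnov2012, Thm 1] -/
theorem hexConnectiveConstant_lt_stripMuY₀_of_ten_thirds_le (hy : 10 / 3 ≤ y) {T : ℕ} (hT : 3 ≤ T) :
    hexConnectiveConstant < stripMuY₀ T y :=
  hexConnectiveConstant_lt_stripMuY₀_of_certificate (by linarith) (by norm_num) hT (by norm_num)
    (certificate_three_of_ten_thirds_le hy) (by nlinarith [Real.sq_sqrt (show (0 : ℝ) ≤ 2 by norm_num), Real.sqrt_nonneg 2])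

/-- **The trivial regime `y > μ² = 2+√2`: every `T ≥ 1`** (the case `D = 1`, `Λ₂(y) ≥ y`, i.e. `μ_T(y,1)² ≥ y`).
[cite: BeatonBousquetMelouDeGierDuminilCopinGuttmann2014, §3.1, Proposition 5 (arXiv v5 p. 9: "μ(y) ≥ max(μ, √y)"); DuminilCopinSmirnov2012, Thm 1] -/
theorem hexConnectiveConstant_lt_stripMuY₀_of_sq_lt (hy : 2 + Real.sqrt 2 < y) {T : ℕ} (hT : 1 ≤ T) :
    hexConnectiveConstant < stripMuY₀ T y := by
  have hy0 : 0 < y := lt_of_le_of_lt (by positivity) hy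
  have h2 : hexConnectiveConstant ^ 2 < stripMuY₀ T y ^ 2 := by
    rw [sq_hexConnectiveConstant_eq_two_add_sqrt_two]
    exact hy.trans_le (le_sq_stripMuY₀ hy0 hT)
  exact lt_of_pow_lt_pow_left₀ 2 (stripMuY₀_pos T hy0).le h2

end Literature.Probability.RandomPlanarGeometry.SAW.HexBW.Wall
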